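import Literature.Analysis.FluidPDE.TypeIAncientMild
import Literature.Analysis.FluidPDE.SelfSimilar
import Literature.Analysis.FluidPDE.PoincareBall
import Mathlib.Analysis.Calculus.FDeriv.Measurable
import HarnessLib

/-!
# Route `LerayQuarterDissipation`, item `RecurrentReductionD` (stmt-NavierStokesRegularity-22507):
# the quarter-rate dissipation law and the singular clause under the Navier–Stokes scaling

Helper file (theorems only, `--supports` the item). The finite-dissipation stratum `𝒟` of the
route consists of Type-I ancient mild fields `w` (KNSS gauge, `IsTypeIAncientMild C w`) whose
slices obey the GLOBAL quarter-rate dissipation law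
`∫_ℝ³ ‖∇w(s)‖² ≤ K/√(−s)` for all `s < 0` (lintegral form). This file records the elementary
structural facts about the law and about the route's singular clause
("`w` exceeds every bound on every backward cylinder `(−r², 0) × B(0, r)`") that the
Birkhoff–Furstenberg reduction to uniformly recurrent profiles consumes:

* `fderiv_nsRescale` — `∇(w_c)(s, x) = c² ∇w(c²s, cx)` for the parabolic rescaling
  `w_c(s, x) = c w(c²s, cx)` (`nsRescale`), with no differentiability hypothesis;
* `lintegral_fderiv_nsRescale_sq` — `∫‖∇w_c(s)‖² = c ∫‖∇w(c²s)‖²` (`c > 0`);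
* `dissipationLaw_nsRescale` — **the law is scale invariant** (it is dimensionless:
  `c · K/√(−c²s) = K/√(−s)`);
* `singularAtOrigin_nsRescale` — the singular clause is scale invariant;
* `dissipationLaw_of_tendsto_fderiv` — **the law is closed under pointwise convergence of the
  gradients** (Fatou's lemma slice by slice).

References: G. Koch, N. Nadirashvili, G. Seregin, V. Šverák, Acta Math. 203 (2009) =
arXiv:0709.3599, §1 (1.2) (the scaling symmetry). [KochNadirashviliSereginSverak2009]
-/

noncomputable section

-- the summit and its single problem share the name (D-0017 nested layout)
set_option linter.dupNamespace false

namespace Summit.NavierStokesRegularity.NavierStokesRegularity.Theorems.RecurrentReductionD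

open MeasureTheory Set Function Filter Topology Metric
open Literature.Analysis.FluidPDE
open scoped ENNReal NNReal

/-! ### The gradient of a rescaled field -/

/-- **Gradient of the parabolic rescaling**: `∇(w_c)(s)(x) = (c·c) • ∇w(c²s)(c x)` for
`w_c(s, x) = c • w(c²s, c x)` — chain rule for the homothety and linearity, both in the
hypothesis-free forms `fderiv_comp_smul`, `fderiv_const_smul_field`. -/
theorem fderiv_nsRescale (c : ℝ) (u : ℝ → (EuclideanSpace ℝ (Fin 3)) → (EuclideanSpace ℝ (Fin 3))) (s : ℝ) (x : (EuclideanSpace ℝ (Fin 3))) :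
    fderiv ℝ (nsRescale c u s) x = (c * c) • fderiv ℝ (u (c ^ 2 * s)) (c • x) := by
  have e : nsRescale c u s = c • (fun y : (EuclideanSpace ℝ (Fin 3)) => u (c ^ 2 * s) (c • y)) := by
    funext y
    simp only [nsRescale_apply, Pi.smul_apply]
  rw [e, fderiv_const_smul_field, Pi.smul_apply]
  rw [show (fun y : (EuclideanSpace ℝ (Fin 3)) => u (c ^ 2 * s) (c • y)) = (u (c ^ 2 * s) <| c • ·) from rfl,
    fderiv_comp_smul, smul_smul]

/-- **`∫‖∇w_c(s)‖² = c ∫‖∇w(c²s)‖²`** for `c > 0`: `‖∇w_c(s)(x)‖² = c⁴‖∇w(c²s)(cx)‖²` and the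
substitution `y = c x` costs `c⁻³` (`PoincareBall.lintegral_comp_smul_add`). -/
theorem lintegral_fderiv_nsRescale_sq {c : ℝ} (hc : 0 < c) (u : ℝ → (EuclideanSpace ℝ (Fin 3)) → (EuclideanSpace ℝ (Fin 3))) (s : ℝ) :
    ∫⁻ x, ‖fderiv ℝ (nsRescale c u s) x‖ₑ ^ 2 =
      ENNReal.ofReal c * ∫⁻ y, ‖fderiv ℝ (u (c ^ 2 * s)) y‖ₑ ^ 2 := by
  have hc0 : c ≠ 0 := hc.ne'
  have e1 : ∀ x, ‖fderiv ℝ (nsRescale c u s) x‖ₑ ^ 2 =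
      ENNReal.ofReal (c ^ 4) * ‖fderiv ℝ (u (c ^ 2 * s)) (c • x)‖ₑ ^ 2 := by
    intro x
    rw [fderiv_nsRescale, enorm_smul, mul_pow]
    congr 1
    rw [Real.enorm_eq_ofReal (by positivity), ← ENNReal.ofReal_pow (by positivity)]
    congr 1
    ring
  simp_rw [e1]
  rw [lintegral_const_mul' _ _ ENNReal.ofReal_ne_top]
  have h2 := PoincareBall.lintegral_comp_smul_add
    (fun y : (EuclideanSpace ℝ (Fin 3)) => ‖fderiv ℝ (u (c ^ 2 * s)) y‖ₑ ^ 2) hc0 0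
  simp only [add_zero] at h2
  rw [h2, ← mul_assoc, finrank_euclideanSpace, Fintype.card_fin]
  congr 1
  rw [← ENNReal.ofReal_mul (by positivity)]
  congr 1
  rw [abs_of_pos (by positivity)]
  field_simp

/-! ### Scale invariance of the dissipation law and of the singular clause -/

/-- **The quarter-rate dissipation law is scale invariant**: if `∫‖∇w(s)‖² ≤ K/√(−s)` for all
`s < 0`, the same holds for `w_c`, `c > 0` (the law is dimensionless:
`c · K/√(−c²s) = K/√(−s)`). [cite: KochNadirashviliSereginSverak2009, §1 (1.2) (arXiv:0709.3599 p. 2)] -/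
theorem dissipationLaw_nsRescale {K : ℝ} {u : ℝ → (EuclideanSpace ℝ (Fin 3)) → (EuclideanSpace ℝ (Fin 3))}
    (hlaw : ∀ s : ℝ, s < 0 → ∫⁻ x, ‖fderiv ℝ (u s) x‖ₑ ^ 2 ≤ ENNReal.ofReal (K / Real.sqrt (-s)))
    {c : ℝ} (hc : 0 < c) :
    ∀ s : ℝ, s < 0 →
      ∫⁻ x, ‖fderiv ℝ (nsRescale c u s) x‖ₑ ^ 2 ≤ ENNReal.ofReal (K / Real.sqrt (-s)) := by
  intro s hs
  have hc2s : c ^ 2 * s < 0 := mul_neg_of_pos_of_neg (by positivity) hs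
  rw [lintegral_fderiv_nsRescale_sq hc]
  calc ENNReal.ofReal c * ∫⁻ y, ‖fderiv ℝ (u (c ^ 2 * s)) y‖ₑ ^ 2
      ≤ ENNReal.ofReal c * ENNReal.ofReal (K / Real.sqrt (-(c ^ 2 * s))) := by
        gcongr
        exact hlaw _ hc2s
    _ = ENNReal.ofReal (K / Real.sqrt (-s)) := by
        rw [← ENNReal.ofReal_mul hc.le]
        congr 1
        have hsq : Real.sqrt (-(c ^ 2 * s)) = c * Real.sqrt (-s) := by
          rw [show -(c ^ 2 * s) = c ^ 2 * (-s) by ring, Real.sqrt_mul' _ (neg_nonneg.2 hs.le),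
            Real.sqrt_sq hc.le]
        rw [hsq]
        have hs' : 0 < Real.sqrt (-s) := Real.sqrt_pos.2 (neg_pos.2 hs)
        field_simp

/-- **The singular clause is scale invariant**: if `u` exceeds every bound on every backward
cylinder `(−r², 0) × B(0, r)` at the origin, so does `u_c`, `c > 0` (apply the hypothesis on
the cylinder of radius `c r` with the bound `M/c`). -/
theorem singularAtOrigin_nsRescale {u : ℝ → (EuclideanSpace ℝ (Fin 3)) → (EuclideanSpace ℝ (Fin 3))}
    (hsing : ∀ r > 0, ∀ M : ℝ, ∃ t ∈ Ioo (-(r ^ 2)) (0 : ℝ),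
      ∃ x ∈ ball (0 : (EuclideanSpace ℝ (Fin 3))) r, M < ‖u t x‖)
    {c : ℝ} (hc : 0 < c) :
    ∀ r > 0, ∀ M : ℝ, ∃ t ∈ Ioo (-(r ^ 2)) (0 : ℝ),
      ∃ x ∈ ball (0 : (EuclideanSpace ℝ (Fin 3))) r, M < ‖nsRescale c u t x‖ := by
  intro r hr M
  obtain ⟨t', ht', x', hx', hM⟩ := hsing (c * r) (by positivity) (M / c)
  have hc2 : 0 < c ^ 2 := by positivity
  refine ⟨t' / c ^ 2, ⟨?_, ?_⟩, c⁻¹ • x', ?_, ?_⟩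
  · have h1 : -((c * r) ^ 2) < t' := ht'.1
    rw [lt_div_iff₀ hc2]
    nlinarith
  · exact div_neg_of_neg_of_pos ht'.2 hc2
  · rw [mem_ball_zero_iff] at hx' ⊢
    rw [norm_smul, norm_inv, Real.norm_of_nonneg hc.le, inv_mul_lt_iff₀ hc]
    exact hx'
  · rw [nsRescale_apply, mul_div_cancel₀ _ hc2.ne', smul_smul, mul_inv_cancel₀ hc.ne', one_smul,
      norm_smul, Real.norm_of_nonneg hc.le]
    rwa [div_lt_iff₀' hc] at hM

/-! ### Closedness of the law under pointwise convergence of the gradients -/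

/-- **The dissipation law passes to pointwise limits of the gradients** (Fatou, slice by
slice): if every `w k` obeys `∫‖∇w_k(s)‖² ≤ K/√(−s)` and `∇w_k(s)(x) → ∇W(s)(x)` at every point
of the open slab, then `W` obeys the same law. -/
theorem dissipationLaw_of_tendsto_fderiv {K : ℝ} {w : ℕ → ℝ → (EuclideanSpace ℝ (Fin 3)) → (EuclideanSpace ℝ (Fin 3))} {W : ℝ → (EuclideanSpace ℝ (Fin 3)) → (EuclideanSpace ℝ (Fin 3))}
    (hlaw : ∀ k, ∀ s : ℝ, s < 0 →
      ∫⁻ x, ‖fderiv ℝ (w k s) x‖ₑ ^ 2 ≤ ENNReal.ofReal (K / Real.sqrt (-s)))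
    (hconv : ∀ s : ℝ, s < 0 → ∀ x : (EuclideanSpace ℝ (Fin 3)),
      Tendsto (fun k => fderiv ℝ (w k s) x) atTop (𝓝 (fderiv ℝ (W s) x))) :
    ∀ s : ℝ, s < 0 → ∫⁻ x, ‖fderiv ℝ (W s) x‖ₑ ^ 2 ≤ ENNReal.ofReal (K / Real.sqrt (-s)) := by
  intro s hs
  have hpt : ∀ x, Tendsto (fun k => ‖fderiv ℝ (w k s) x‖ₑ ^ 2) atTop
      (𝓝 (‖fderiv ℝ (W s) x‖ₑ ^ 2)) := fun x =>
    ((ENNReal.continuous_pow 2).tendsto _).comp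
      ((continuous_enorm.tendsto _).comp (hconv s hs x))
  have e : (fun x => ‖fderiv ℝ (W s) x‖ₑ ^ 2) =
      fun x => liminf (fun k => ‖fderiv ℝ (w k s) x‖ₑ ^ 2) atTop := by
    funext x
    exact ((hpt x).liminf_eq).symm
  rw [e]
  refine (lintegral_liminf_le fun k => ?_).trans ?_
  · exact ((measurable_fderiv ℝ (w k s)).enorm.pow_const 2)
  · exact liminf_le_of_frequently_le' (Eventually.of_forall fun k => hlaw k s hs).frequently

end Summit.NavierStokesRegularity.NavierStokesRegularity.Theorems.RecurrentReductionD

end
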